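import Summits.QuantumFields.BalabanUV.Beta.GAN24.TableDressingDefect
import Summits.QuantumFields.BalabanUV.Beta.GAN24.CoProjSlotCharges
import Summits.QuantumFields.BalabanUV.Beta.GaugeMultiplierBlockMean
import Summits.QuantumFields.BalabanUV.Beta.AveragingPointsOfView
import Summits.QuantumFields.BalabanUV.Beta.SymSliceProjectorSpread

/-!
# `BalabanUV.Beta.GAN24.TableDressingProjector` — binder row G-an2-4 ∕ (CONV-C), CT-W (routes (R-DEV) ∕ (R-GRW) ∕ CT-W3 of the row owner's RULINGS R-gan24p1-g23-1∕2):
# **`Πᵀ_bm` BLOCK-AVERAGES THE DIVERGENCE OF A SLOT AND FIXES EVERY SLOT WHOSE DIVERGENCE IS BLOCK-CONSTANT; HENCE IT IS IDEMPOTENT** — the one-variable dressings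
# `P₂, P₁, L₁, L₂` composing the table dressing `𝔇` are PROJECTORS, and the slot divergences of a dressed slot are the BLOCK MEANS of the undressed ones (= the currency of
# the tree's block-summed Ward table laws)

NOT IN PRINT; OUR BOOKKEEPING (G-an2-4 crux team (2), leaf prover `b2b-balaban-gan24-formalise-leaf-06`, gen 43; journal INTENT [GAN24LEAF06-G43-INTENT3]).
HONEST FRAMING (cell contract, verbatim): «discharging `BetaPertH` makes Bałaban's UV stability UNCONDITIONAL — a real constructive-QFT result; it is NOT the
continuum limit and NOT the Clay problem.»  HONEST DEPENDENCY (verbatim): «continuum YM on T⁴ ⇐ BetaPertH ∧ nine spine estimates (0/9 proved); BetaPertH ⇐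
(D1) ∧ (D4) ∧ CAP+tail; G-an2-4 gates asym, D1 and NE2/3/4.»

WHY.  `TableDressingDefect` displays `𝔇 − 1` as four one-slot defects `Σ' φ_{α,q} · div`.  Two facts about the block-mean-normalised projector close the algebra of `𝔇`:
(i) an2's `GaugeMultiplierBlockMean.codiff₁_rowBm`: the codifferential of every ROW of `Π_bm` is `dz (blockMeanAt N 𝟙_u)` — summed against a slot this says
`div (Πᵀ_bm g) = blockMeanAt N (div g)`: CO-PROJECTING A SLOT REPLACES ITS DIVERGENCE BY THE BLOCK MEAN (so a dressed slot carries exactly the BLOCK-SUMMED divergence that the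
tree's Ward table laws — `WardLocusQuarticTable.tableLaw_*`, `KernelWardHColumnWall.colH_ward_*` — control); (ii) the defect potential `φ_{α,q} = bmGaugeAt ρ δ_{(α,q)} N` is
supported in the block of `q` (leaf-02's `bmGaugeAt_bondInd_eq_zero_of_blk_ne`) with ZERO block sum (an2's `blockSum_bmGaugeAt`), so `Σ' φ_{α,q} · div g = 0` whenever `div g` is
CONSTANT ON THE BLOCK of `q`: `Πᵀ_bm` FIXES every slot with block-constant divergence (leaf-02's «divergence-free ⇒ fixed» is the case `0`).  (i)+(ii): `Πᵀ_bm ∘ Πᵀ_bm = Πᵀ_bm`.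

WHAT ([folklore] bookkeeping BY NAME; in-block root `ρ = toSite r`, `1 ≤ N`, generic `d`; 0 `def`, 0 cite, 0 `def … : Prop`, 0 sorry):
§1 ONE-FORM LEVEL — (the window sum as a lattice sum is leaf-02 g52's `CoProjSlotCharges.coProjBmAt_eq_tsum`, used BY NAME) **`div_coProjBmAt`** (`Σ_α ((Πᵀg) α q − (Πᵀg) α (q − e_α)) = (N^{d+1})⁻¹·Σ_{b ∈ box} div g (N•blk q + b)`),
   **`coProjBmAt_eq_self_of_blockConst_div`**, **`coProjBmAt_idem`**.
§2 SLOT LEVEL — `coProj_snd_idem`, `coProj_fst_idem`, `legCo₁_idem`, `legCo₂_idem` (each one-variable dressing of `𝔇` is a projector); `div_coProj_snd`, `div_coProj_fst`,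
   `div_legCo₁_inl`, `div_legCo₂_inl` (the divergence of a dressed slot ∕ field leg is the block mean of the undressed one).
§3 `coProj_snd ∕ coProj_fst ∕ legCo₁ ∕ legCo₂_eq_self_of_blockConst_div`, **`tableDress_eq_self_of_blockConst_div`** — a table whose four slot divergences are
   BLOCK-CONSTANT is `𝔇`-fixed (widening `TableDressingDefect.tableDress_eq_self_of_transversal`) — so this class lies inside the image of `𝔇`; conversely each
   one-variable dressing outputs a block-constant divergence in ITS variable (§2); the four-slot converse for the composite `𝔇` (every `𝔇`-image has block-constant
   divergence in all four variables) needs the slot commutations and is `TableDressingIdempotent` §4 — together: Im `𝔇` = {four slot divergences block-constant}.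
Asserts NO value of any divergence of Bałaban's tables; 0 estimate; discharges NOTHING of (Z′) ∕ (G′) ∕ (F3ᴱ-irr) ∕ «T2Shape» ∕ «T2Drift» ∕ (hW, hWall); NEVER «G-an2-4 closed» as
(CONV-C); NOT D1, NOT `BetaPertH`, NOT continuum, NOT Clay; not in print — our bookkeeping.  Unit `b2b-balaban-gan24-formalise-leaf-06` (gen 43), 2026-08-22.
-/

noncomputable section

open Finset
open scoped BigOperators
open Literature.MathematicalPhysics.QuantumFieldTheory
open Literature.MathematicalPhysics.QuantumFieldTheory.Balaban1983to89
open Literature.MathematicalPhysics.QuantumFieldTheory.Balaban1983to89.Beta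
open ExpKernelCalculus (MKer Site)
open AffineAveraging (Form0 Form1 box toSite unitVec dz blockSum codiff₁)
open AveragingContours (blk off off_mem_box blk_add_off blk_block)
open OneStepResolventKernel (Fib)
open Summit.QuantumFields.BalabanUV.Beta.AxialProjectorBlockMean (blockMeanAt bmGaugeAt)
open Summit.QuantumFields.BalabanUV.Beta.AxialDressingRooted (bondInd cube mem_cube pmBm coProjBmAt coProjBmAt_apply coProjBmAtK coProjBmAtK_eval
  legCo₁BmAt legCo₂BmAt legCo₁BmAt_inl legCo₁BmAt_inr legCo₂BmAt_inl legCo₂BmAt_inr window_of_pmBm_ne_zero tsum_window dressKBmAt)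
open Summit.QuantumFields.BalabanUV.Beta.BorderedHessian (rowBm rowBm_apply codiff₁_rowBm blockMeanAt_ind ind)
open Summit.QuantumFields.BalabanUV.Beta.AveragingPointsOfView (blockSum_bmGaugeAt)
open Summit.QuantumFields.BalabanUV.Beta.SymSliceProjectorSpread (tsum_block_of)
open Summit.QuantumFields.BalabanUV.Beta.GAN24.BiStencilZeroMode (Tab)
open Summit.QuantumFields.BalabanUV.Beta.GAN24.CoProjBmDivFree (bmGaugeAt_bondInd_eq_zero_of_blk_ne)
open Summit.QuantumFields.BalabanUV.Beta.GAN24.TableDressingDefect (coProjBmAt_sub_self_apply)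
open Summit.QuantumFields.BalabanUV.Beta.GAN24.CoProjSlotCharges (coProjBmAt_eq_tsum)

namespace Summit.QuantumFields.BalabanUV.Beta.GAN24.TableDressingProjector

variable {d : ℕ} {N : ℕ} {r : Fin (d + 1) → ℕ}

/-! ## §1 One-form level: `div ∘ Πᵀ_bm = blockMean ∘ div`; block-constant divergence is fixed; idempotence -/

/-- [folklore] The matrix column `w ↦ pmBm ρ N β w α q · g β w` is finitely supported (window `q + cube`), hence summable. -/
theorem summable_pmBm_mul (hN : 1 ≤ N) (hr : r ∈ box (d + 1) N) (g : Form1 (d + 1) ℝ) (β α : Fin (d + 1)) (q : Fin (d + 1) → ℤ) :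
    Summable fun w : Fin (d + 1) → ℤ => pmBm (toSite r) N β w α q * g β w := by
  classical
  refine summable_of_ne_finset_zero (s := (cube (d + 1) N).image fun v => q + v) fun w hw => ?_
  by_cases hp : pmBm (toSite r) N β w α q = 0
  · rw [hp, zero_mul]
  · exact absurd (Finset.mem_image.2 ⟨w - q, window_of_pmBm_ne_zero hN hr hp, by abel⟩) hw

/-- NOT IN PRINT; OUR BOOKKEEPING.  **CO-PROJECTING A SLOT BLOCK-AVERAGES ITS DIVERGENCE** (in-block root, `1 ≤ N`, ANY one-form `g`):
`Σ_α ((Πᵀ_bm g) α q − (Πᵀ_bm g) α (q − e_α)) = (N^{d+1})⁻¹ · Σ_{b ∈ box} Σ_β (g β (N•blk q + b) − g β (N•blk q + b − e_β))` — the divergence of the dressed slot at `q` is the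
MEAN over the block of `q` of the divergence of `g` (an2's `codiff₁_rowBm`: every row of `Π_bm` has codifferential `dz (blockMeanAt N 𝟙_q)`).  So a dressed slot carries exactly the
BLOCK-SUMMED divergence — the quantity the tree's Ward table laws control. -/
theorem div_coProjBmAt (hN : 1 ≤ N) (hr : r ∈ box (d + 1) N) (g : Form1 (d + 1) ℝ) (q : Fin (d + 1) → ℤ) :
    ∑ α : Fin (d + 1), (coProjBmAt (toSite r) N g α q - coProjBmAt (toSite r) N g α (q - unitVec α))
      = (((N : ℝ) ^ (d + 1))⁻¹) * ∑ b ∈ box (d + 1) N, ∑ β : Fin (d + 1),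
          (g β ((N : ℤ) • blk N q + toSite b) - g β ((N : ℤ) • blk N q + toSite b - unitVec β)) := by
  classical
  have hs := fun β α q => summable_pmBm_mul hN hr g β α q
  -- Step 1: the divergence of `Πᵀ g` at `q` is `Σ_β Σ'_w g β w · (−codiff₁ (rowBm β w) q)`
  have e1 : ∑ α : Fin (d + 1), (coProjBmAt (toSite r) N g α q - coProjBmAt (toSite r) N g α (q - unitVec α))
      = ∑ β : Fin (d + 1), ∑' w : Fin (d + 1) → ℤ, g β w * -(codiff₁ (rowBm (toSite r) N β w) q) := by
    simp only [coProjBmAt_eq_tsum hN hr]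
    have e2 : ∀ α : Fin (d + 1), ((∑ β : Fin (d + 1), ∑' w, pmBm (toSite r) N β w α q * g β w)
          - ∑ β : Fin (d + 1), ∑' w, pmBm (toSite r) N β w α (q - unitVec α) * g β w)
        = ∑ β : Fin (d + 1), ∑' w, (pmBm (toSite r) N β w α q - pmBm (toSite r) N β w α (q - unitVec α)) * g β w := by
      intro α
      rw [← Finset.sum_sub_distrib]
      refine Finset.sum_congr rfl fun β _ => ?_
      rw [← (hs β α q).tsum_sub (hs β α (q - unitVec α))]
      exact tsum_congr fun w => by ring
    rw [Finset.sum_congr rfl fun α _ => e2 α, Finset.sum_comm]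
    refine Finset.sum_congr rfl fun β _ => ?_
    have hsd : ∀ α : Fin (d + 1), Summable fun w : Fin (d + 1) → ℤ =>
        (pmBm (toSite r) N β w α q - pmBm (toSite r) N β w α (q - unitVec α)) * g β w := fun α =>
      ((hs β α q).sub (hs β α (q - unitVec α))).congr (fun w => by ring)
    rw [← Summable.tsum_finsetSum (fun α _ => hsd α)]
    refine tsum_congr fun w => ?_
    simp only [codiff₁, rowBm_apply]
    rw [← Finset.sum_neg_distrib, Finset.mul_sum]
    exact Finset.sum_congr rfl fun α _ => by ring
  rw [e1]
  -- Step 2: `−codiff₁ (rowBm β w) q = (N^{d+1})⁻¹ · ([blk q = blk w] − [blk q = blk (w + e_β)])`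
  have e3 : ∀ (β : Fin (d + 1)) (w : Fin (d + 1) → ℤ), g β w * -(codiff₁ (rowBm (toSite r) N β w) q)
      = (((N : ℝ) ^ (d + 1))⁻¹) * ((if blk N q = blk N w then g β w else 0) - (if blk N q = blk N (w + unitVec β) then g β w else 0)) := by
    intro β w
    rw [codiff₁_rowBm (toSite r) hN β w q]
    simp only [dz, blockMeanAt_ind hN]
    split_ifs <;> ring
  simp only [e3]
  -- summability of the block-supported families
  have hsI : ∀ h : (Fin (d + 1) → ℤ) → ℝ, Summable fun w : Fin (d + 1) → ℤ => (if blk N q = blk N w then h w else 0) := by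
    intro h
    refine summable_of_ne_finset_zero (s := (box (d + 1) N).image fun b => (N : ℤ) • blk N q + toSite b) fun w hw => ?_
    rw [if_neg]
    intro hblk
    refine hw (Finset.mem_image.2 ⟨off N w, off_mem_box hN w, ?_⟩)
    rw [hblk]; exact blk_add_off hN w
  have eB : ∀ β : Fin (d + 1), (fun w : Fin (d + 1) → ℤ => if blk N q = blk N (w + unitVec β) then g β w else 0)
      = (fun w' : Fin (d + 1) → ℤ => if blk N q = blk N w' then g β (w' - unitVec β) else 0) ∘ (Equiv.addRight (unitVec β)) := by
    intro β; funext w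
    simp only [Function.comp_apply, Equiv.coe_addRight, add_sub_cancel_right]
  have hsB : ∀ β : Fin (d + 1), Summable fun w : Fin (d + 1) → ℤ => (if blk N q = blk N (w + unitVec β) then g β w else 0) := by
    intro β; rw [eB β]; exact (Equiv.addRight (unitVec β)).summable_iff.2 (hsI _)
  -- Step 3: both lattice sums collapse to the block of `q`
  have tA : ∀ β : Fin (d + 1), ∑' w : Fin (d + 1) → ℤ, (if blk N q = blk N w then g β w else 0)
      = ∑ b ∈ box (d + 1) N, g β ((N : ℤ) • blk N q + toSite b) := fun β => tsum_block_of hN q (g β)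
  have tB : ∀ β : Fin (d + 1), ∑' w : Fin (d + 1) → ℤ, (if blk N q = blk N (w + unitVec β) then g β w else 0)
      = ∑ b ∈ box (d + 1) N, g β ((N : ℤ) • blk N q + toSite b - unitVec β) := by
    intro β
    have h1 : (∑' w : Fin (d + 1) → ℤ, (if blk N q = blk N (w + unitVec β) then g β w else 0))
        = ∑' w : Fin (d + 1) → ℤ, (fun w' : Fin (d + 1) → ℤ => if blk N q = blk N w' then g β (w' - unitVec β) else 0)
            (Equiv.addRight (unitVec β) w) := by
      refine tsum_congr fun w => ?_
      simp only [Equiv.coe_addRight, add_sub_cancel_right]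
    exact h1.trans ((((Equiv.addRight (unitVec β)).tsum_eq
      (fun w' : Fin (d + 1) → ℤ => if blk N q = blk N w' then g β (w' - unitVec β) else 0))).trans
        (tsum_block_of hN q (fun x => g β (x - unitVec β))))
  rw [Finset.sum_congr rfl fun β _ => by rw [tsum_mul_left, (hsI (g β)).tsum_sub (hsB β), tA β, tB β], ← Finset.mul_sum]
  congr 1
  rw [Finset.sum_comm]
  exact Finset.sum_congr rfl fun b _ => by rw [Finset.sum_sub_distrib]

/-- NOT IN PRINT; OUR BOOKKEEPING.  **`Πᵀ_bm` FIXES EVERY SLOT WHOSE DIVERGENCE IS BLOCK-CONSTANT** (in-block root, `1 ≤ N`; NO decay hypothesis): if `div g p = div g p′` whenever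
`blk N p = blk N p′`, then `coProjBmAt ρ N g = g` — the defect `Σ'_p φ_{α,q}(p)·div g(p)` (leaf-02's formula) sees `div g` only on the block of `q`, where it is the constant
`div g (q)`, against the potential `φ_{α,q}` of ZERO block sum (an2's `blockSum_bmGaugeAt`).  leaf-02's `coProjBmAt_eq_self_of_divFree` is the case `div g = 0`. -/
theorem coProjBmAt_eq_self_of_blockConst_div (hN : 1 ≤ N) (hr : r ∈ box (d + 1) N) {g : Form1 (d + 1) ℝ}
    (hdiv : ∀ p p' : Fin (d + 1) → ℤ, blk N p = blk N p' →
      ∑ β : Fin (d + 1), (g β p - g β (p - unitVec β)) = ∑ β : Fin (d + 1), (g β p' - g β (p' - unitVec β))) :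
    coProjBmAt (toSite r) N g = g := by
  classical
  funext α q
  rw [← sub_eq_zero, coProjBmAt_sub_self_apply hN hr g α q]
  set φ : Form0 (d + 1) ℝ := bmGaugeAt (toSite r) (fun κ z => (bondInd α q κ z : ℝ)) N with hφ
  -- on the block of `q` the divergence is the constant `div g q`; off it `φ` vanishes
  have e : (fun p : Fin (d + 1) → ℤ => φ p * ∑ β : Fin (d + 1), (g β p - g β (p - unitVec β)))
      = fun p => (if blk N q = blk N p then φ p else 0) * ∑ β : Fin (d + 1), (g β q - g β (q - unitVec β)) := by
    funext p
    by_cases hb : blk N q = blk N p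
    · rw [if_pos hb, hdiv p q hb.symm]
    · rw [if_neg hb, zero_mul, hφ, bmGaugeAt_bondInd_eq_zero_of_blk_ne hN hr α q (fun h => hb h.symm), zero_mul]
  rw [e, tsum_mul_right, tsum_block_of hN q φ]
  have h0 : ∑ b ∈ box (d + 1) N, φ ((N : ℤ) • blk N q + toSite b) = 0 := by
    have h := congrFun (blockSum_bmGaugeAt hN (toSite r) (fun κ z => (bondInd α q κ z : ℝ))) (blk N q)
    simpa only [blockSum, Pi.zero_apply] using h
  rw [h0, zero_mul]

/-- [folklore] The block mean of a divergence is block-constant (it depends on the point only through its block). -/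
theorem div_coProjBmAt_blockConst (hN : 1 ≤ N) (hr : r ∈ box (d + 1) N) (g : Form1 (d + 1) ℝ) {p p' : Fin (d + 1) → ℤ} (h : blk N p = blk N p') :
    ∑ α : Fin (d + 1), (coProjBmAt (toSite r) N g α p - coProjBmAt (toSite r) N g α (p - unitVec α))
      = ∑ α : Fin (d + 1), (coProjBmAt (toSite r) N g α p' - coProjBmAt (toSite r) N g α (p' - unitVec α)) := by
  rw [div_coProjBmAt hN hr g p, div_coProjBmAt hN hr g p', h]

/-- NOT IN PRINT; OUR BOOKKEEPING.  **`Πᵀ_bm` IS IDEMPOTENT** (in-block root, `1 ≤ N`, ANY one-form): `coProjBmAt ρ N (coProjBmAt ρ N g) = coProjBmAt ρ N g` — the dressed slot has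
block-constant divergence (`div_coProjBmAt`), hence is fixed (`coProjBmAt_eq_self_of_blockConst_div`).  (Dual of an2's `axProjBmAt_idem`.) -/
theorem coProjBmAt_idem (hN : 1 ≤ N) (hr : r ∈ box (d + 1) N) (g : Form1 (d + 1) ℝ) :
    coProjBmAt (toSite r) N (coProjBmAt (toSite r) N g) = coProjBmAt (toSite r) N g :=
  coProjBmAt_eq_self_of_blockConst_div hN hr fun _ _ h => div_coProjBmAt_blockConst hN hr g h

/-! ## §2 Slot level: the four one-variable dressings of `𝔇` are projectors; dressed slots carry block-averaged divergences -/

/-- NOT IN PRINT; OUR BOOKKEEPING.  **THE SECOND-SOURCE-SLOT DRESSING IS A PROJECTOR**: `P₂ (P₂ X) = P₂ X`. -/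
theorem coProj_snd_idem (hN : 1 ≤ N) (hr : r ∈ box (d + 1) N) (X : Tab d) :
    (fun κ u => coProjBmAtK (toSite r) N ((fun κ u => coProjBmAtK (toSite r) N (X κ u)) κ u)) = fun κ u => coProjBmAtK (toSite r) N (X κ u) := by
  funext κ u κ' u' x z a b
  rw [coProjBmAtK_eval, coProjBmAtK_eval]
  have e : (fun κ₁ u₁ => coProjBmAtK (toSite r) N (X κ u) κ₁ u₁ x z a b) = coProjBmAt (toSite r) N (fun κ₁ u₁ => X κ u κ₁ u₁ x z a b) := by
    funext κ₁ u₁; rw [coProjBmAtK_eval]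
  rw [e, coProjBmAt_idem hN hr]

/-- NOT IN PRINT; OUR BOOKKEEPING.  **THE FIRST-SOURCE-SLOT DRESSING IS A PROJECTOR**: `P₁ (P₁ Y) = P₁ Y`. -/
theorem coProj_fst_idem (hN : 1 ≤ N) (hr : r ∈ box (d + 1) N) (Y : Tab d) :
    (fun κ u κ' u' => coProjBmAtK (toSite r) N
        (fun κ₁ u₁ => (fun κ u κ' u' => coProjBmAtK (toSite r) N (fun κ₂ u₂ => Y κ₂ u₂ κ' u') κ u) κ₁ u₁ κ' u') κ u)
      = fun κ u κ' u' => coProjBmAtK (toSite r) N (fun κ₁ u₁ => Y κ₁ u₁ κ' u') κ u := by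
  funext κ u κ' u' x z a b
  rw [coProjBmAtK_eval, coProjBmAtK_eval]
  have e : (fun κ₁ u₁ => coProjBmAtK (toSite r) N (fun κ₂ u₂ => Y κ₂ u₂ κ' u') κ₁ u₁ x z a b)
      = coProjBmAt (toSite r) N (fun κ₂ u₂ => Y κ₂ u₂ κ' u' x z a b) := by
    funext κ₁ u₁; rw [coProjBmAtK_eval]
  rw [e, coProjBmAt_idem hN hr]

/-- NOT IN PRINT; OUR BOOKKEEPING.  **THE FIRST-KERNEL-LEG DRESSING IS A PROJECTOR**: `legCo₁BmAt ρ N (legCo₁BmAt ρ N V) = legCo₁BmAt ρ N V`. -/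
theorem legCo₁_idem (hN : 1 ≤ N) (hr : r ∈ box (d + 1) N) (V : MKer (d + 1) (Fib d)) :
    legCo₁BmAt (toSite r) N (legCo₁BmAt (toSite r) N V) = legCo₁BmAt (toSite r) N V := by
  funext x z a b
  rcases a with α | m
  · rw [legCo₁BmAt_inl, legCo₁BmAt_inl]
    have e : (fun α' x' => legCo₁BmAt (toSite r) N V x' z (Sum.inl α') b) = coProjBmAt (toSite r) N (fun α' x' => V x' z (Sum.inl α') b) := by
      funext α' x'; rw [legCo₁BmAt_inl]
    rw [e, coProjBmAt_idem hN hr]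
  · rw [legCo₁BmAt_inr, legCo₁BmAt_inr]

/-- NOT IN PRINT; OUR BOOKKEEPING.  **THE SECOND-KERNEL-LEG DRESSING IS A PROJECTOR**: `legCo₂BmAt ρ N (legCo₂BmAt ρ N V) = legCo₂BmAt ρ N V`. -/
theorem legCo₂_idem (hN : 1 ≤ N) (hr : r ∈ box (d + 1) N) (V : MKer (d + 1) (Fib d)) :
    legCo₂BmAt (toSite r) N (legCo₂BmAt (toSite r) N V) = legCo₂BmAt (toSite r) N V := by
  funext x z a b
  rcases b with β₀ | m
  · rw [legCo₂BmAt_inl, legCo₂BmAt_inl]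
    have e : (fun β' y' => legCo₂BmAt (toSite r) N V x y' a (Sum.inl β')) = coProjBmAt (toSite r) N (fun β' y' => V x y' a (Sum.inl β')) := by
      funext β' y'; rw [legCo₂BmAt_inl]
    rw [e, coProjBmAt_idem hN hr]
  · rw [legCo₂BmAt_inr, legCo₂BmAt_inr]

/-- NOT IN PRINT; OUR BOOKKEEPING.  **THE DRESSED SECOND SOURCE SLOT CARRIES THE BLOCK-AVERAGED DIVERGENCE**:
`Σ_β ((P₂ X) κ u β p x z a b − (P₂ X) κ u β (p − e_β) x z a b) = (N^{d+1})⁻¹·Σ_{b′ ∈ box} Σ_β (X κ u β (N•blk p + b′) x z a b − X κ u β (N•blk p + b′ − e_β) x z a b)`. -/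
theorem div_coProj_snd (hN : 1 ≤ N) (hr : r ∈ box (d + 1) N) (X : Tab d) (κ : Fin (d + 1)) (u p x z : Fin (d + 1) → ℤ) (a b : Fib d) :
    ∑ β : Fin (d + 1), (coProjBmAtK (toSite r) N (X κ u) β p x z a b - coProjBmAtK (toSite r) N (X κ u) β (p - unitVec β) x z a b)
      = (((N : ℝ) ^ (d + 1))⁻¹) * ∑ b' ∈ box (d + 1) N, ∑ β : Fin (d + 1),
          (X κ u β ((N : ℤ) • blk N p + toSite b') x z a b - X κ u β ((N : ℤ) • blk N p + toSite b' - unitVec β) x z a b) := by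
  simp only [coProjBmAtK_eval]
  exact div_coProjBmAt hN hr (fun κ₁ u₁ => X κ u κ₁ u₁ x z a b) p

/-- NOT IN PRINT; OUR BOOKKEEPING.  **THE DRESSED FIRST SOURCE SLOT CARRIES THE BLOCK-AVERAGED DIVERGENCE**. -/
theorem div_coProj_fst (hN : 1 ≤ N) (hr : r ∈ box (d + 1) N) (Y : Tab d) (p : Fin (d + 1) → ℤ) (κ' : Fin (d + 1)) (u' x z : Fin (d + 1) → ℤ) (a b : Fib d) :
    ∑ β : Fin (d + 1), (coProjBmAtK (toSite r) N (fun κ₁ u₁ => Y κ₁ u₁ κ' u') β p x z a b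
        - coProjBmAtK (toSite r) N (fun κ₁ u₁ => Y κ₁ u₁ κ' u') β (p - unitVec β) x z a b)
      = (((N : ℝ) ^ (d + 1))⁻¹) * ∑ b' ∈ box (d + 1) N, ∑ β : Fin (d + 1),
          (Y β ((N : ℤ) • blk N p + toSite b') κ' u' x z a b - Y β ((N : ℤ) • blk N p + toSite b' - unitVec β) κ' u' x z a b) := by
  simp only [coProjBmAtK_eval]
  exact div_coProjBmAt hN hr (fun κ₁ u₁ => Y κ₁ u₁ κ' u' x z a b) p

/-- NOT IN PRINT; OUR BOOKKEEPING.  **THE DRESSED FIRST FIELD LEG CARRIES THE BLOCK-AVERAGED DIVERGENCE**: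
`Σ_β ((legCo₁BmAt ρ N V) p z (inl β) b − (legCo₁BmAt ρ N V) (p − e_β) z (inl β) b) = (N^{d+1})⁻¹·Σ_{b′∈box} Σ_β (V (N•blk p + b′) z (inl β) b − V (N•blk p + b′ − e_β) z (inl β) b)`. -/
theorem div_legCo₁_inl (hN : 1 ≤ N) (hr : r ∈ box (d + 1) N) (V : MKer (d + 1) (Fib d)) (p z : Fin (d + 1) → ℤ) (b : Fib d) :
    ∑ β : Fin (d + 1), (legCo₁BmAt (toSite r) N V p z (Sum.inl β) b - legCo₁BmAt (toSite r) N V (p - unitVec β) z (Sum.inl β) b)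
      = (((N : ℝ) ^ (d + 1))⁻¹) * ∑ b' ∈ box (d + 1) N, ∑ β : Fin (d + 1),
          (V ((N : ℤ) • blk N p + toSite b') z (Sum.inl β) b - V ((N : ℤ) • blk N p + toSite b' - unitVec β) z (Sum.inl β) b) := by
  simp only [legCo₁BmAt_inl]
  exact div_coProjBmAt hN hr (fun α' x' => V x' z (Sum.inl α') b) p

/-- NOT IN PRINT; OUR BOOKKEEPING.  **THE DRESSED SECOND FIELD LEG CARRIES THE BLOCK-AVERAGED DIVERGENCE**. -/
theorem div_legCo₂_inl (hN : 1 ≤ N) (hr : r ∈ box (d + 1) N) (V : MKer (d + 1) (Fib d)) (x p : Fin (d + 1) → ℤ) (a : Fib d) :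
    ∑ β : Fin (d + 1), (legCo₂BmAt (toSite r) N V x p a (Sum.inl β) - legCo₂BmAt (toSite r) N V x (p - unitVec β) a (Sum.inl β))
      = (((N : ℝ) ^ (d + 1))⁻¹) * ∑ b' ∈ box (d + 1) N, ∑ β : Fin (d + 1),
          (V x ((N : ℤ) • blk N p + toSite b') a (Sum.inl β) - V x ((N : ℤ) • blk N p + toSite b' - unitVec β) a (Sum.inl β)) := by
  simp only [legCo₂BmAt_inl]
  exact div_coProjBmAt hN hr (fun β' y' => V x y' a (Sum.inl β')) p


/-! ## §3 A table whose four slot divergences are block-constant is `𝔇`-fixed -/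

/-- [folklore] **A TABLE BLOCK-CONSTANT-DIVERGENT IN ITS SECOND SOURCE SLOT IS `P₂`-FIXED** (`coProjBmAt_eq_self_of_blockConst_div` slot by slot). -/
theorem coProj_snd_eq_self_of_blockConst_div (hN : 1 ≤ N) (hr : r ∈ box (d + 1) N) {X : Tab d}
    (hdiv : ∀ (κ : Fin (d + 1)) (u x z : Fin (d + 1) → ℤ) (a b : Fib d) (p p' : Fin (d + 1) → ℤ), blk N p = blk N p' →
      ∑ β : Fin (d + 1), (X κ u β p x z a b - X κ u β (p - unitVec β) x z a b)
        = ∑ β : Fin (d + 1), (X κ u β p' x z a b - X κ u β (p' - unitVec β) x z a b)) :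
    (fun κ u => coProjBmAtK (toSite r) N (X κ u)) = X := by
  funext κ u κ' u' x z a b
  rw [coProjBmAtK_eval, coProjBmAt_eq_self_of_blockConst_div hN hr (g := fun κ₁ u₁ => X κ u κ₁ u₁ x z a b)
    (fun p p' h => hdiv κ u x z a b p p' h)]

/-- [folklore] **A TABLE BLOCK-CONSTANT-DIVERGENT IN ITS FIRST SOURCE SLOT IS `P₁`-FIXED**. -/
theorem coProj_fst_eq_self_of_blockConst_div (hN : 1 ≤ N) (hr : r ∈ box (d + 1) N) {Y : Tab d}
    (hdiv : ∀ (κ' : Fin (d + 1)) (u' x z : Fin (d + 1) → ℤ) (a b : Fib d) (p p' : Fin (d + 1) → ℤ), blk N p = blk N p' →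
      ∑ β : Fin (d + 1), (Y β p κ' u' x z a b - Y β (p - unitVec β) κ' u' x z a b)
        = ∑ β : Fin (d + 1), (Y β p' κ' u' x z a b - Y β (p' - unitVec β) κ' u' x z a b)) :
    (fun κ u κ' u' => coProjBmAtK (toSite r) N (fun κ₁ u₁ => Y κ₁ u₁ κ' u') κ u) = Y := by
  funext κ u κ' u' x z a b
  rw [coProjBmAtK_eval, coProjBmAt_eq_self_of_blockConst_div hN hr (g := fun κ₁ u₁ => Y κ₁ u₁ κ' u' x z a b)
    (fun p p' h => hdiv κ' u' x z a b p p' h)]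

/-- [folklore] **A KERNEL BLOCK-CONSTANT-DIVERGENT IN ITS FIRST FIELD LEG IS `legCo₁BmAt`-FIXED**. -/
theorem legCo₁_eq_self_of_blockConst_div (hN : 1 ≤ N) (hr : r ∈ box (d + 1) N) {V : MKer (d + 1) (Fib d)}
    (hdiv : ∀ (z : Fin (d + 1) → ℤ) (b : Fib d) (p p' : Fin (d + 1) → ℤ), blk N p = blk N p' →
      ∑ β : Fin (d + 1), (V p z (Sum.inl β) b - V (p - unitVec β) z (Sum.inl β) b)
        = ∑ β : Fin (d + 1), (V p' z (Sum.inl β) b - V (p' - unitVec β) z (Sum.inl β) b)) :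
    legCo₁BmAt (toSite r) N V = V := by
  funext x z a b
  rcases a with α | m
  · rw [legCo₁BmAt_inl, coProjBmAt_eq_self_of_blockConst_div hN hr (g := fun α' x' => V x' z (Sum.inl α') b) (fun p p' h => hdiv z b p p' h)]
  · rw [legCo₁BmAt_inr]

/-- [folklore] **A KERNEL BLOCK-CONSTANT-DIVERGENT IN ITS SECOND FIELD LEG IS `legCo₂BmAt`-FIXED**. -/
theorem legCo₂_eq_self_of_blockConst_div (hN : 1 ≤ N) (hr : r ∈ box (d + 1) N) {V : MKer (d + 1) (Fib d)}
    (hdiv : ∀ (x : Fin (d + 1) → ℤ) (a : Fib d) (p p' : Fin (d + 1) → ℤ), blk N p = blk N p' →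
      ∑ β : Fin (d + 1), (V x p a (Sum.inl β) - V x (p - unitVec β) a (Sum.inl β))
        = ∑ β : Fin (d + 1), (V x p' a (Sum.inl β) - V x (p' - unitVec β) a (Sum.inl β))) :
    legCo₂BmAt (toSite r) N V = V := by
  funext x z a b
  rcases b with β₀ | m
  · rw [legCo₂BmAt_inl, coProjBmAt_eq_self_of_blockConst_div hN hr (g := fun β' y' => V x y' a (Sum.inl β')) (fun p p' h => hdiv x a p p' h)]
  · rw [legCo₂BmAt_inr]

/-- NOT IN PRINT; OUR BOOKKEEPING.  **A TABLE WHOSE FOUR SLOT DIVERGENCES ARE BLOCK-CONSTANT IS `𝔇`-FIXED** (in-block root, `1 ≤ N`; no decay hypothesis) — the widening of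
`TableDressingDefect.tableDress_eq_self_of_transversal` from divergence-FREE to divergence-BLOCK-CONSTANT slots; with `div_coProjBmAt` (a dressed slot has block-constant
divergence, §2) every table of this class is a `𝔇`-image; the converse inclusion (every `𝔇`-image is in the class) is `TableDressingIdempotent` §4. -/
theorem tableDress_eq_self_of_blockConst_div (hN : 1 ≤ N) (hr : r ∈ box (d + 1) N) {X : Tab d}
    (h₂ : ∀ (κ : Fin (d + 1)) (u x z : Fin (d + 1) → ℤ) (a b : Fib d) (p p' : Fin (d + 1) → ℤ), blk N p = blk N p' →
      ∑ β : Fin (d + 1), (X κ u β p x z a b - X κ u β (p - unitVec β) x z a b)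
        = ∑ β : Fin (d + 1), (X κ u β p' x z a b - X κ u β (p' - unitVec β) x z a b))
    (h₁ : ∀ (κ' : Fin (d + 1)) (u' x z : Fin (d + 1) → ℤ) (a b : Fib d) (p p' : Fin (d + 1) → ℤ), blk N p = blk N p' →
      ∑ β : Fin (d + 1), (X β p κ' u' x z a b - X β (p - unitVec β) κ' u' x z a b)
        = ∑ β : Fin (d + 1), (X β p' κ' u' x z a b - X β (p' - unitVec β) κ' u' x z a b))
    (hL₁ : ∀ (κ : Fin (d + 1)) (u : Fin (d + 1) → ℤ) (κ' : Fin (d + 1)) (u' z : Fin (d + 1) → ℤ) (b : Fib d) (p p' : Fin (d + 1) → ℤ),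
      blk N p = blk N p' →
      ∑ β : Fin (d + 1), (X κ u κ' u' p z (Sum.inl β) b - X κ u κ' u' (p - unitVec β) z (Sum.inl β) b)
        = ∑ β : Fin (d + 1), (X κ u κ' u' p' z (Sum.inl β) b - X κ u κ' u' (p' - unitVec β) z (Sum.inl β) b))
    (hL₂ : ∀ (κ : Fin (d + 1)) (u : Fin (d + 1) → ℤ) (κ' : Fin (d + 1)) (u' x : Fin (d + 1) → ℤ) (a : Fib d) (p p' : Fin (d + 1) → ℤ),
      blk N p = blk N p' →
      ∑ β : Fin (d + 1), (X κ u κ' u' x p a (Sum.inl β) - X κ u κ' u' x (p - unitVec β) a (Sum.inl β))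
        = ∑ β : Fin (d + 1), (X κ u κ' u' x p' a (Sum.inl β) - X κ u κ' u' x (p' - unitVec β) a (Sum.inl β))) :
    (fun κ u κ' u' => dressKBmAt (toSite r) N (coProjBmAtK (toSite r) N (fun κ₁ u₁ => coProjBmAtK (toSite r) N (X κ₁ u₁) κ' u') κ u)) = X := by
  have e₂ : (fun κ u => coProjBmAtK (toSite r) N (X κ u)) = X := coProj_snd_eq_self_of_blockConst_div hN hr h₂
  have e₂' : ∀ κ₁ u₁, coProjBmAtK (toSite r) N (X κ₁ u₁) = X κ₁ u₁ := fun κ₁ u₁ => congrFun (congrFun e₂ κ₁) u₁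
  have e₁ : (fun κ u κ' u' => coProjBmAtK (toSite r) N (fun κ₁ u₁ => X κ₁ u₁ κ' u') κ u) = X := coProj_fst_eq_self_of_blockConst_div hN hr h₁
  rw [TableDressingDefect.tableDress_eq_legs]
  funext κ u κ' u'
  simp only [e₂']
  have e₁' : coProjBmAtK (toSite r) N (fun κ₁ u₁ => X κ₁ u₁ κ' u') κ u = X κ u κ' u' :=
    congrFun (congrFun (congrFun (congrFun e₁ κ) u) κ') u'
  rw [e₁', legCo₁_eq_self_of_blockConst_div hN hr (fun z b p p' h => hL₁ κ u κ' u' z b p p' h),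
    legCo₂_eq_self_of_blockConst_div hN hr (fun x a p p' h => hL₂ κ u κ' u' x a p p' h)]

end Summit.QuantumFields.BalabanUV.Beta.GAN24.TableDressingProjector

end
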